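import Mathlib
import Literature.Geometry.Lorentzian.ChartCalculus
import Literature.Geometry.Lorentzian.BoundedGeometry
import Literature.Geometry.Lorentzian.KerrSchild
import Summits.FinalStateConjecture.FinalStateConjecture.Theorems.PhotonSphereChannelsTameCensorshipPinNondegenerate

/-!
# Route PhotonSphereChannels · crux `TameCensorship` (stmt-FinalStateConjecture-17431) · line `Sketch` ·
# stub `stub_christoffelBound`: the Christoffel map of a pinned chart metric is bounded by `∂G`

Helper file (`--supports stmt-FinalStateConjecture-17431`) of line `Sketch` (lead c2, 2026-08-17), a brick of the
PANCAKE LAW. In a tame chart `Ψ : U → 𝒟` of clause (ii) the metric components `G = Ψ^* g` on `U : Opens E4` are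
pinned to the Minkowski form, `‖G x − η‖ ≤ ½`, and have bounded first derivatives `‖DG(x) v‖ ≤ L ‖v‖`. A geodesic
read in the chart obeys `x'' = −Γ_x(x', x')`, so the forced-speed estimate needs `‖Γ_x(X₀, Y₀)‖ ≤ K ‖X₀‖ ‖Y₀‖`.
This file proves it with `K = 3 L`: by the Koszul formula (`OpensChart.two_mul_val_christoffel`,
O'Neill 1983, Ch. 3, Prop. 3.13) `2 G_x(Γ_x(X₀, Y₀), Z₀) = ∂_{X₀}G(Y₀, Z₀) + ∂_{Y₀}G(Z₀, X₀) − ∂_{Z₀}G(X₀, Y₀)`, each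
term is `≤ L ‖X₀‖ ‖Y₀‖ ‖Z₀‖`, so the functional `G_x(Γ_x(X₀, Y₀), ·)` has operator norm `≤ 3/2 · L ‖Y₀‖ ‖X₀‖`, and the
quantitative non-degeneracy `‖w‖ ≤ 2 ‖G_x(w, ·)‖` under the pin (`stub_pinNondegenerate`) raises the index.

References: B. O'Neill, *Semi-Riemannian Geometry* (1983), Ch. 3, Def. 3.12 and Prop. 3.13.
-/

set_option linter.dupNamespace false

-- instance search through the nested operator type `E4 →L[ℝ] E4 →L[ℝ] ℝ` (as in the tree's chart files)
set_option maxSynthPendingDepth 3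

open Literature.Geometry.Lorentzian
open scoped Manifold ContDiff Topology

noncomputable section

namespace Summit.FinalStateConjecture.FinalStateConjecture.Theorems.PhotonSphereChannels.TameCensorshipUnwind

/-- Trilinear operator-norm bound for the derivative of the metric components: if `‖DG(x) v‖ ≤ L ‖v‖` for all `v`,
then `|DG(x)(A)(B, C)| ≤ L ‖A‖ ‖B‖ ‖C‖` (`ContinuousLinearMap.le_opNorm₂`). [folklore] -/
private theorem chrBd_abs_fderiv_apply₃_le {G : E4 → E4 →L[ℝ] E4 →L[ℝ] ℝ} {x : E4} {L : ℝ}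
    (hL : ∀ v : E4, ‖fderiv ℝ G x v‖ ≤ L * ‖v‖) (A B C : E4) :
    |fderiv ℝ G x A B C| ≤ L * ‖A‖ * ‖B‖ * ‖C‖ := by
  have h1 := (fderiv ℝ G x A).le_opNorm₂ B C
  rw [Real.norm_eq_abs] at h1
  refine h1.trans ?_
  have h2 : ‖fderiv ℝ G x A‖ * ‖B‖ * ‖C‖ ≤ L * ‖A‖ * ‖B‖ * ‖C‖ :=
    mul_le_mul_of_nonneg_right (mul_le_mul_of_nonneg_right (hL A) (norm_nonneg B)) (norm_nonneg C)
  exact h2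

/-- The Koszul form under a first-derivative bound: `|K_x(Y₀)(X₀, Z₀)| ≤ 3 L ‖Y₀‖ ‖X₀‖ ‖Z₀‖`
(three first derivatives of `G`, `OpensChart.koszulForm_apply`). [cite: ONeill1983, Ch. 3, Prop. 3.13] -/
private theorem chrBd_abs_koszulForm_le {G : E4 → E4 →L[ℝ] E4 →L[ℝ] ℝ} {x : E4} {L : ℝ}
    (hL : ∀ v : E4, ‖fderiv ℝ G x v‖ ≤ L * ‖v‖) (Y₀ X₀ Z₀ : E4) :
    |OpensChart.koszulForm G x Y₀ X₀ Z₀| ≤ 3 * L * ‖Y₀‖ * ‖X₀‖ * ‖Z₀‖ := by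
  rw [OpensChart.koszulForm_apply]
  have h1 := chrBd_abs_fderiv_apply₃_le hL X₀ Y₀ Z₀
  have h2 := chrBd_abs_fderiv_apply₃_le hL Y₀ Z₀ X₀
  have h3 := chrBd_abs_fderiv_apply₃_le hL Z₀ X₀ Y₀
  calc |fderiv ℝ G x X₀ Y₀ Z₀ + fderiv ℝ G x Y₀ Z₀ X₀ - fderiv ℝ G x Z₀ X₀ Y₀|
      ≤ |fderiv ℝ G x X₀ Y₀ Z₀| + |fderiv ℝ G x Y₀ Z₀ X₀| + |fderiv ℝ G x Z₀ X₀ Y₀| :=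
        (abs_sub _ _).trans (add_le_add (abs_add_le _ _) le_rfl)
    _ ≤ L * ‖X₀‖ * ‖Y₀‖ * ‖Z₀‖ + L * ‖Y₀‖ * ‖Z₀‖ * ‖X₀‖ + L * ‖Z₀‖ * ‖X₀‖ * ‖Y₀‖ := by gcongr
    _ = 3 * L * ‖Y₀‖ * ‖X₀‖ * ‖Z₀‖ := by ring

/-- **Stub `stub_christoffelBound` of line `Sketch` for the crux `PhotonSphereChannels.TameCensorship`
(stmt-FinalStateConjecture-17431): the Christoffel map under the pin is bounded by the first derivatives of the
components** (O'Neill 1983, Ch. 3, Prop. 3.13). For a metric `g` on `U : Opens E4` with components `G`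
(`g.val y = G y`), at a point `x` with `‖G x − η‖ ≤ ½` and `‖DG(x) v‖ ≤ L ‖v‖`:
`‖Γ_x(X₀, Y₀)‖ ≤ 3 L ‖Y₀‖ ‖X₀‖` for `OpensChart.christoffel g G x Y₀ X₀`. Proof: with `w = Γ_x(X₀, Y₀)`,
`2 G_x(w, Z₀) = K_x(Y₀)(X₀, Z₀)` (`OpensChart.two_mul_val_christoffel` and `g.val x = G x`) and
`|K_x(Y₀)(X₀, Z₀)| ≤ 3 L ‖Y₀‖ ‖X₀‖ ‖Z₀‖`, so `‖G_x(w, ·)‖ ≤ 3/2 · L ‖Y₀‖ ‖X₀‖`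
(`ContinuousLinearMap.opNorm_le_bound`); then `‖w‖ ≤ 2 ‖G_x(w, ·)‖` (`stub_pinNondegenerate`).
[cite: ONeill1983, Ch. 3, Prop. 3.13] -/
theorem stub_christoffelBound :
    ∀ (U : TopologicalSpace.Opens E4)
    (g : PseudoRiemannianMetric 𝓘(ℝ, E4) ∞ E4 (TangentSpace 𝓘(ℝ, E4) : U → Type _))
    (G : E4 → E4 →L[ℝ] E4 →L[ℝ] ℝ) (x : U) (L : ℝ),
    (∀ y : U, g.val y = G y) → ‖G x - Minkowski.bilin‖ ≤ 1 / 2 → (∀ v : E4, ‖fderiv ℝ G x v‖ ≤ L * ‖v‖) →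
    ∀ Y₀ X₀ : E4, ‖OpensChart.christoffel g G x Y₀ X₀‖ ≤ 3 * L * ‖Y₀‖ * ‖X₀‖ := by
  intro U g G x L hG hpin hL Y₀ X₀
  set w : E4 := OpensChart.christoffel g G x Y₀ X₀
  -- the Koszul formula, read through `g.val x = G x`
  have hkey : ∀ Z₀ : E4, 2 * G x w Z₀ = OpensChart.koszulForm G x Y₀ X₀ Z₀ := fun Z₀ ↦ by
    have h := OpensChart.two_mul_val_christoffel (g := g) (G := G) x Y₀ X₀ Z₀
    rw [hG x] at h
    exact h
  -- `0 ≤ L ‖Y₀‖` (from the derivative bound at `Y₀`)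
  have hLY : 0 ≤ L * ‖Y₀‖ := (norm_nonneg _).trans (hL Y₀)
  have hM : 0 ≤ 3 / 2 * L * ‖Y₀‖ * ‖X₀‖ := by
    have : 0 ≤ 3 / 2 * (L * ‖Y₀‖) * ‖X₀‖ := by positivity
    simpa [mul_assoc] using this
  -- operator norm of the functional `G_x(w, ·)`
  have hop : ‖G x w‖ ≤ 3 / 2 * L * ‖Y₀‖ * ‖X₀‖ := by
    refine ContinuousLinearMap.opNorm_le_bound _ hM fun Z₀ ↦ ?_
    rw [Real.norm_eq_abs]
    have h1 := chrBd_abs_koszulForm_le hL Y₀ X₀ Z₀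
    rw [← hkey Z₀, abs_mul, abs_two] at h1
    linarith
  -- index raising under the pin
  have hnd := stub_pinNondegenerate (G x) hpin w
  linarith

end Summit.FinalStateConjecture.FinalStateConjecture.Theorems.PhotonSphereChannels.TameCensorshipUnwind

end
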